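import Literature.NumberTheory.Transcendental.CurvePeriodsEllipticLiftLinearityProofs
import HarnessLib

/-!
# Periods of curve type on an elliptic curve, XI: arbitrary paths, from the analytic subgroup theorem

Companion of `Literature/NumberTheory/Transcendental/CurvePeriods.lean` (Huber–Wüstholz 2022,
Thm. 13.3 (2) = Kontsevich's period conjecture for periods of curve type, rendered on explicit
period symbols `(Z, ω, γ)` with the elementary relations (R1)–(R5); general statement: the named
fact `HuberWustholzCurvePeriods`) and the assembly of the genus-one files
`CurvePeriodsElliptic{Forms,Segments,Doubling,Lift,Polygon,Grid,Endgame,Translation,LiftInvariance,LiftCalculus,LiftLinearity}Proofs.lean`.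
For a period pair `L` with algebraic invariants `g₂, g₃` and WITHOUT complex multiplication, the
sub-diagram

  `{E_L with ARBITRARY paths with algebraic end points} ∪ {𝔾ₘ, 𝔸¹, punctured lines Z_a}`

of the theorem is proved from ONE existing named fact of the tree taken as a hypothesis,
`Literature.NumberTheory.Transcendental.analyticSubgroupTheorem_GaGmE` (Wüstholz's analytic
subgroup theorem for `𝔾ₐ × 𝔾ₘ^ι × (E♮)^κ` at all algebraic points, `AnalyticSubgroupElliptic.lean`;
its instance at period vectors is a theorem, `analyticSubgroupTheorem_GaGmE_periods_holds`, which
suffices for CLOSED paths: `CurvePeriodsEllipticEndgameHolds.lean`). The periods concerned are all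
1-periods of one non-CM elliptic curve over `ℚ̄` relative to finitely many algebraic points: the
`ℚ̄`-combinations of `1`, logarithms of algebraic numbers and incomplete elliptic integrals of the
first and second kind between algebraic points (`u`, `ζ(u)`; among them `ωᵢ, ηᵢ`).

* `Ell.liftPart` — the part `Σ_l A_l S₀[D_l] + Σ_l B_l S₁[D_l]` of a combination carried by basis
  lifts `D_l : t₀ ↝ t₀ + m_l`, with its period `Σ 2A_l m_l − Σ 2B_l (ζ(t₀ + m_l) − ζ(t₀))`;
* `Ell.exists_liftData_rel` — every symbol `(E_L, ω, γ)` is `a S₀[D] + b S₁[D] + e𝟙` for a lift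
  `D` of `γ` (`Ell.exists_lift'`, `Weier.exists_rel_symbol`);
* `Ell.isUnivExtAlgPoint_shift` — `(m, ζ(t₀ + m) − ζ(t₀))` exponentiates to a `ℚ̄`-point of `E♮`
  for an algebraic logarithm `m` and a generic algebraic `t₀` (quasi-periodicity over `O`, the
  addition theorem for `ζ` otherwise);
* `huberWustholzCurvePeriods_of_ellipticPaths` — **the theorem**: with a generic algebraic base
  point `t₀` (`Ell.exists_generic_algPt`), translation invariance rewrites every lift
  `z₀ ↝ z₁` as `t₀ ↝ t₀ + (z₁ − z₀)` (`Ell.LiftData.span_translate_theta0/1`); the displacements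
  generate a free `ℤ`-module (`Module.basisOfFiniteTypeTorsionFree'`), and `Ell.zexpand` expresses
  every such symbol through the lifts `t₀ ↝ t₀ + m_l` of a `ℤ`-basis; the logarithms are expanded
  in a `ℚ`-basis as in `CurvePeriodsGmBakerProofs.lean`; the period of the normal form vanishes,
  and the analytic subgroup theorem at `u = (1; (log mᵢ); (m_l, ζ(t₀ + m_l) − ζ(t₀))_l)` — whose
  degenerate alternatives are excluded by `1 ≠ 0`, the `ℚ`-independence of the logarithms and the
  `ℤ`-independence of the `m_l` — forces all coefficients to vanish;
* `huberWustholzCurvePeriods_of_puncturedLine_or_ellipticPaths` — adding all punctured lines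
  (`exists_transfer_puncturedLine`, `span_of_transfer_finsupp`).

What is NOT here: `E_L` minus further points (integrals of the third kind: extensions of `E` by
`𝔾ₘ`), CM curves, several curves, genus `≥ 2` — the general fact `HuberWustholzCurvePeriods`.

## References

* A. Huber, G. Wüstholz, *Transcendence and Linear Relations of 1-Periods*, Cambridge Tracts in
  Mathematics 227, CUP 2022 [HuberWustholz2022]: Thm. 13.3 (2) (p. 121 of the held text), §13.2
  and Thm. 13.9 (pp. 122–125), Ch. 15 (dimension computations), §18.1–18.2 (p. 160 ff.),
  Lemma 8.13, Thm. 6.2 (analytic subgroup theorem).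
* G. Wüstholz, *Algebraische Punkte auf analytischen Untergruppen algebraischer Gruppen*,
  Ann. of Math. 129 (1989), 501–517 (here only through the named fact
  `analyticSubgroupTheorem_GaGmE`). [Wustholz1989]
* J. V. Armitage, W. F. Eberlein, *Elliptic Functions*, CUP 2006, §7.4.2. [ArmitageEberlein2001]
-/

noncomputable section

open scoped BigOperators
open scoped PeriodPair
open scoped Topology
open MvPolynomial Set Complex Filter Metric

namespace Literature.NumberTheory.Transcendental

namespace CurvePeriods

set_option quotPrecheck false in
/-- Membership in the `ℚ̄`-span of the elementary relations, in the format of the conclusion of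
`HuberWustholzCurvePeriods`. -/
local notation "InSpan" c:max => ∃ (k : ℕ) (ρ : Fin k → (PeriodSymbol →₀ ℂ)) (a : Fin k → ℂ),
  (∀ l, IsElementaryRelation (ρ l)) ∧ (∀ l, IsAlgebraic ℚ (a l)) ∧ c = ∑ l, a l • ρ l

namespace Ell

section Parts

variable {L : PeriodPair} (h₂ : IsAlgebraic ℚ L.g₂) (h₃ : IsAlgebraic ℚ L.g₃)

local notation3 "S₀[" D "]" => LiftData.sym h₂ h₃ D (theta0 L) (hasAlgCoeffs_theta0 L h₂ h₃)
local notation3 "S₁[" D "]" => LiftData.sym h₂ h₃ D (theta1 L) (hasAlgCoeffs_theta1 L h₂ h₃)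
local notation3 "𝟙" => (Finsupp.single PeriodSymbol.unit (1 : ℂ) : PeriodSymbol →₀ ℂ)

/-! ### The part of a combination carried by the basis lifts -/

/-- **The lift part** `Σ_l A_l S₀[D_l] + Σ_l B_l S₁[D_l]` of a combination, for a family of lifts
`D_l : t₀ ↝ t₀ + m_l`. [folklore] -/
def liftPart {r : ℕ} {t₀ : ℂ} {m : Fin r → ℂ} (DU : ∀ l, LiftData L t₀ (t₀ + m l))
    (A B : Fin r → ℂ) : PeriodSymbol →₀ ℂ :=
  ∑ l, A l • S₀[DU l] + ∑ l, B l • S₁[DU l]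

variable {r : ℕ} {t₀ : ℂ} {m : Fin r → ℂ} (DU : ∀ l, LiftData L t₀ (t₀ + m l))

/-- [folklore] -/
theorem liftPart_zero : liftPart h₂ h₃ DU 0 0 = 0 := by
  simp [liftPart]

/-- [folklore] -/
theorem liftPart_add (A B A' B' : Fin r → ℂ) :
    liftPart h₂ h₃ DU A B + liftPart h₂ h₃ DU A' B' = liftPart h₂ h₃ DU (A + A') (B + B') := by
  simp only [liftPart, Pi.add_apply, add_smul, Finset.sum_add_distrib]
  abel

/-- [folklore] -/
theorem smul_liftPart (x : ℂ) (A B : Fin r → ℂ) :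
    x • liftPart h₂ h₃ DU A B = liftPart h₂ h₃ DU (x • A) (x • B) := by
  simp only [liftPart, smul_add, Finset.smul_sum, smul_smul, Pi.smul_apply, smul_eq_mul]

/-- [folklore] -/
theorem liftPart_finset_sum {ι : Type*} (T : Finset ι) (A B : ι → Fin r → ℂ) :
    ∑ s ∈ T, liftPart h₂ h₃ DU (A s) (B s) = liftPart h₂ h₃ DU (∑ s ∈ T, A s) (∑ s ∈ T, B s) := by
  classical
  induction T using Finset.induction_on with
  | empty => simp [liftPart_zero]
  | insert a T ha ih => rw [Finset.sum_insert ha, Finset.sum_insert ha, Finset.sum_insert ha, ih,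
      liftPart_add]

/-- **The period of the lift part**: `Σ_l 2A_l m_l − Σ_l 2B_l (ζ(t₀ + m_l) − ζ(t₀))`.
[cite: HuberWustholz2022, §18.1 (p. 160)] -/
theorem evalCombination_liftPart (A B : Fin r → ℂ) :
    evalCombination (liftPart h₂ h₃ DU A B) =
      ∑ l, A l * (2 * m l) +
        ∑ l, B l * (-2 * (L.weierstrassZeta (t₀ + m l) - L.weierstrassZeta t₀)) := by
  simp only [liftPart, evalCombination_add, evalCombination_finsetSum, evalCombination_smul,
    LiftData.evalCombination_sym_theta0, LiftData.evalCombination_sym_theta1, add_sub_cancel_left]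

/-! ### Every symbol on `E_L` through a lift -/

/-- **Every symbol `(E_L, ω, γ)` is `a·S₀[D] + b·S₁[D] + e·𝟙` modulo the relations**, for a lift
`D` of `γ` (`Ell.exists_lift'`) and `a, b, e ∈ ℚ̄` (de Rham reduction, `Weier.exists_rel_symbol`).
[cite: HuberWustholz2022, §13.2 (p. 123), §3.3.1 (p. 44)] -/
theorem exists_liftData_rel (ω : Fin 2 → MvPolynomial (Fin 2) ℂ) (hω : ∀ k, HasAlgCoeffs (ω k))
    (γ : CurvePath (curve L)) :
    ∃ (z₀ z₁ : ℂ) (D : LiftData L z₀ z₁) (a b e : ℂ), IsAlgebraic ℚ a ∧ IsAlgebraic ℚ b ∧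
      IsAlgebraic ℚ e ∧
      InSpan (Finsupp.single (⟨curve L, smooth L h₂ h₃, ω, hω, γ⟩ : PeriodSymbol) (1 : ℂ) -
        a • S₀[D] - b • S₁[D] - e • 𝟙) := by
  have hE := smooth L h₂ h₃
  obtain ⟨g, hgC, hgΛ, hgφ, hv0, hv1⟩ := exists_lift' L γ
  set D : LiftData L (g 0) (g 1) := ⟨g, hgC, hgΛ, rfl, rfl, hv0, hv1⟩ with hD
  obtain ⟨a, b, e, ha, hb, he, hrel⟩ := Weier.exists_rel_symbol (A L) (B L) (isAlgebraic_A L h₂)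
    (isAlgebraic_B L h₃) (disc_ne_zero L) ω hω γ
  have r0 := mem_span_sub_of_eqOn hE (theta0 L) (hasAlgCoeffs_theta0 L h₂ h₃) γ D.path
    (fun t ht => by rw [LiftData.path_toFun]; exact hgφ t ht)
  have r1 := mem_span_sub_of_eqOn hE (theta1 L) (hasAlgCoeffs_theta1 L h₂ h₃) γ D.path
    (fun t ht => by rw [LiftData.path_toFun]; exact hgφ t ht)
  refine ⟨g 0, g 1, D, a, b, e, ha, hb, he, ?_⟩
  obtain ⟨K, ρ, cf, hρ, hcf, hsum⟩ := span_add (span_add hrel (span_smul ha r0)) (span_smul hb r1)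
  refine ⟨K, ρ, cf, hρ, hcf, ?_⟩
  rw [← hsum]
  simp only [LiftData.sym, smul_sub]
  abel

/-! ### The points of `E♮` over the basis lifts -/

omit h₃ in
/-- **`(m, ζ(t₀ + m) − ζ(t₀))` exponentiates to a `ℚ̄`-point of `E♮`** for an algebraic
logarithm `m` and a generic algebraic base point `t₀`: over `O` it is `(aω₁ + bω₂, aη₁ + bη₂)`
(quasi-periodicity), otherwise `ζ(t₀ + m) − ζ(t₀) − ζ(m) = ½(℘′(m) − ℘′(t₀))/(℘(m) − ℘(t₀)) ∈ ℚ̄`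
(addition theorem for `ζ`). [cite: HuberWustholz2022, §18.1–18.2, Lemma 8.13] [cite: ArmitageEberlein2001, §7.4.2] -/
theorem isUnivExtAlgPoint_shift {t₀ m : ℂ} (ht₀ : IsAlgPt L t₀) (hm : AlgLog L m)
    (hp : t₀ + m ∉ L.lattice) (hmi : t₀ - m ∉ L.lattice) :
    L.IsUnivExtAlgPoint m (L.weierstrassZeta (t₀ + m) - L.weierstrassZeta t₀) := by
  by_cases hmΛ : m ∈ L.lattice
  · obtain ⟨a, b, hab⟩ := PeriodPair.mem_lattice.1 hmΛ
    refine Or.inl ⟨a, b, hab.symm, ?_⟩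
    rw [← hab, L.weierstrassZeta_add_period a b t₀]
    simpa using isAlgebraic_zero
  · have hmalg : IsAlgPt L m := hm.isAlgPt hmΛ
    have hne : ℘[L] m ≠ ℘[L] t₀ := by
      refine (weierstrassP_ne_iff L hmΛ ht₀.1).2 ⟨by rwa [add_comm], ?_⟩
      intro h
      exact hmi (by simpa using neg_mem h)
    refine Or.inr ⟨hmΛ, hmalg.weierstrassP, ?_⟩
    rw [add_comm t₀ m, L.weierstrassZeta_add_holds m t₀ hmΛ ht₀.1 hne]
    have e : L.weierstrassZeta m + L.weierstrassZeta t₀ +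
        (℘'[L] m - ℘'[L] t₀) / (℘[L] m - ℘[L] t₀) / 2 - L.weierstrassZeta t₀ - L.weierstrassZeta m =
        (℘'[L] m - ℘'[L] t₀) / (℘[L] m - ℘[L] t₀) / 2 := by ring
    rw [e]
    exact ((hmalg.derivWeierstrassP.sub ht₀.derivWeierstrassP).mul
      (hmalg.weierstrassP.sub ht₀.weierstrassP).inv).mul (isAlgebraic_two.inv)

end Parts

end Ell

/-! ### The theorem: arbitrary paths on `E_L`, with `𝔾ₘ` and `𝔸¹` -/

section Main

local notation3 "logSym " E:arg => (⟨⟨2, 1, ![X 0 * X 1 - 1]⟩, isSmoothAffineCurve_mulGroup,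
  ![X 1, 0], hasAlgCoeffs_ydx, E⟩ : PeriodSymbol)

/-- `ℤ`-linearly independent numbers admit no non-trivial integer relation. [folklore] -/
theorem not_int_rel_of_linearIndependent_int {ι : Type*} [Fintype ι] {m : ι → ℂ}
    (hli : LinearIndependent ℤ m) (p : ι → ℤ) (hp : p ≠ 0)
    (hrel : ∑ i, (p i : ℂ) * m i = 0) : False := by
  have hsum : ∑ i, p i • m i = 0 := by
    simpa only [zsmul_eq_mul] using hrel
  have h0 := Fintype.linearIndependent_iff.mp hli p hsum
  exact hp (funext h0)

/-- **Huber–Wüstholz, Theorem 13.3 (2), for ARBITRARY paths on a non-CM elliptic curve together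
with `𝔾ₘ` and `𝔸¹` — from the analytic subgroup theorem.** Let `Λ` be a lattice with algebraic
invariants `g₂, g₃` and without complex multiplication, `E_L : y² = x³ − (g₂/4)x − g₃/4`. Assume
Wüstholz's analytic subgroup theorem for `𝔾ₐ × 𝔾ₘ^ι × (E♮)^κ` at algebraic points (the named fact
`analyticSubgroupTheorem_GaGmE`, taken as a hypothesis). Then every vanishing `ℚ̄`-linear
combination of period symbols `(E_L, ω, γ)` (ANY polynomial form over `ℚ̄`, ANY `C¹` path with
algebraic end points — closed or not), `(𝔾ₘ, ω, γ)` and `(𝔸¹, ω, γ)` is a `ℚ̄`-linear combination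
of the elementary relations (R1)–(R5). The periods concerned are the `ℚ̄`-combinations of `1`,
logarithms of algebraic numbers, and incomplete elliptic integrals of the first and second kind
between algebraic points of `E_L` (among them `ω₁, ω₂, η₁, η₂`).

Proof: every symbol on `E_L` is `a S₀[D] + b S₁[D] + e𝟙` for a lift `D : z₀ ↝ z₁`
(`Ell.exists_liftData_rel`); with a generic algebraic base point `t₀` (`Ell.exists_generic_algPt`)
translation invariance gives `S[z₀ ↝ z₁] ∼ S[t₀ ↝ t₀ + w]`, `w = z₁ − z₀`
(`Ell.LiftData.span_translate_theta0/1`); the `w`'s generate a free `ℤ`-module with basis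
`m_1, …, m_r` (`Module.basisOfFiniteTypeTorsionFree'`), and `ℤ`-linearity (`Ell.zexpand`) rewrites
every `S[t₀ ↝ t₀ + w]` through the basis lifts `S[t₀ ↝ t₀ + m_l]`, whose periods are `2m_l` and
`−2(ζ(t₀ + m_l) − ζ(t₀))`; the logarithms are treated as in `CurvePeriodsGmBakerProofs.lean`. The
period of the resulting normal form vanishes, and the analytic subgroup theorem at
`u = (1; (log m_i); (m_l, ζ(t₀ + m_l) − ζ(t₀))_l)` — a point over `G(ℚ̄)` by
`Ell.isUnivExtAlgPoint_shift`, with degenerate alternatives excluded by `1 ≠ 0` and the `ℚ`- resp.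
`ℤ`-independence of the `log m_i` resp. `m_l` — forces all coefficients to vanish. This is the
sub-diagram of all pairs `(E_L, D)` (with `𝔾ₘ`, `𝔸¹`) of the book's Thm. 13.3 (2) (§13.2,
Thm. 13.9; Ch. 15), made unconditional up to the one named fact.
[cite: HuberWustholz2022, Thm. 13.3 (2) (p. 121), §13.2 and Thm. 13.9 (pp. 122–125), Ch. 15, §18.1 (p. 160), Thm. 6.2] -/
theorem huberWustholzCurvePeriods_of_ellipticPaths (hAST : analyticSubgroupTheorem_GaGmE)
    (L : PeriodPair) (h₂ : IsAlgebraic ℚ L.g₂) (h₃ : IsAlgebraic ℚ L.g₃) (hCM : ¬ L.HasCM)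
    (c : PeriodSymbol →₀ ℂ) (hc : ∀ s, IsAlgebraic ℚ (c s))
    (hsupp : ∀ s ∈ c.support,
      s.Z = Ell.curve L ∨ s.Z = (⟨2, 1, ![X 0 * X 1 - 1]⟩ : CurveData) ∨ s.Z = CurveData.affineLine)
    (h0 : evalCombination c = 0) :
    ∃ (k : ℕ) (ρ : Fin k → (PeriodSymbol →₀ ℂ)) (a : Fin k → ℂ),
      (∀ l, IsElementaryRelation (ρ l)) ∧ (∀ l, IsAlgebraic ℚ (a l)) ∧ c = ∑ l, a l • ρ l := by
  classical
  obtain ⟨E00, hE00⟩ := exists_expPath (L₀ := 0) (L₁ := 0) isAlgebraic_exp_zero isAlgebraic_exp_zero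
  have hg00 : Ell.IsAlgPt L (Ell.vtx L 0 (0, 0)) := Ell.isAlgPt_vtx L h₂ h₃ 0 (0, 0)
  set D00 : Ell.LiftData L (Ell.vtx L 0 (0, 0)) (Ell.vtx L 0 (0, 0)) := Ell.LiftData.const hg00
  -- Phase A: raw data of every symbol
  have key : ∀ s : PeriodSymbol, ∃ (z₀ z₁ : ℂ) (D : Ell.LiftData L z₀ z₁) (a b : ℂ) (M : ℂ)
      (E : CurvePath (⟨2, 1, ![X 0 * X 1 - 1]⟩ : CurveData)) (d e : ℂ), s ∈ c.support →
      (IsAlgebraic ℚ a ∧ IsAlgebraic ℚ b ∧ IsAlgebraic ℚ (exp M) ∧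
        (∀ t, E.toFun t = ![exp ((1 - t) * 0 + t * M), exp (-((1 - t) * 0 + t * M))]) ∧
        IsAlgebraic ℚ d ∧ IsAlgebraic ℚ e ∧
        InSpan (Finsupp.single s (1 : ℂ) -
          a • D.sym h₂ h₃ (Ell.theta0 L) (Ell.hasAlgCoeffs_theta0 L h₂ h₃) -
          b • D.sym h₂ h₃ (Ell.theta1 L) (Ell.hasAlgCoeffs_theta1 L h₂ h₃) -
          d • Finsupp.single (logSym E) (1 : ℂ) -
          e • Finsupp.single PeriodSymbol.unit (1 : ℂ))) := by
    intro s
    by_cases hs : s ∈ c.support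
    · rcases hsupp s hs with hsZ | hGA
      · obtain ⟨Z, hZ, ω, hω, γ⟩ := s
        dsimp only at hsZ
        subst hsZ
        obtain rfl : hZ = Ell.smooth L h₂ h₃ := rfl
        obtain ⟨z₀, z₁, D, a, b, e, ha, hb, he, hrel⟩ := Ell.exists_liftData_rel h₂ h₃ ω hω γ
        refine ⟨z₀, z₁, D, a, b, 0, E00, 0, e, fun _ =>
          ⟨ha, hb, isAlgebraic_exp_zero, hE00, isAlgebraic_zero, he, ?_⟩⟩
        obtain ⟨k, ρ, cf, hρ, hcf, hsum⟩ := hrel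
        exact ⟨k, ρ, cf, hρ, hcf, by rw [← hsum, zero_smul, sub_zero]⟩
      · obtain ⟨M, E, d, e, h1, h2, h3, h4, h5⟩ := exists_logSym_rel s hGA
        refine ⟨_, _, D00, 0, 0, M, E, d, e, fun _ =>
          ⟨isAlgebraic_zero, isAlgebraic_zero, h1, h2, h3, h4, ?_⟩⟩
        obtain ⟨k, ρ, cf, hρ, hcf, hsum⟩ := h5
        exact ⟨k, ρ, cf, hρ, hcf, by rw [← hsum, zero_smul, zero_smul, sub_zero, sub_zero]⟩
    · exact ⟨_, _, D00, 0, 0, 0, E00, 0, 0, fun h => (hs h).elim⟩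
  choose z₀ z₁ Dl a b M E d e hkey using key
  -- Phase B: the ℤ-module generated by the lifted displacements `w s = z₁ s − z₀ s`
  set w : PeriodSymbol → ℂ := fun s => z₁ s - z₀ s with hw
  have hwA : ∀ s, Ell.AlgLog L (w s) := fun s =>
    ((Dl s).alg_stop.algLog).sub L h₂ (Dl s).alg_start.algLog
  set Wf : Finset ℂ := c.support.image w with hWf
  set Msp : Submodule ℤ ℂ := Submodule.span ℤ (Wf : Set ℂ) with hMsp
  obtain ⟨r, bM⟩ : Σ n : ℕ, Module.Basis (Fin n) ℤ Msp := Module.basisOfFiniteTypeTorsionFree'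
  set m : Fin r → ℂ := fun l => (bM l : ℂ) with hm
  have hMalg : ∀ x ∈ Msp, Ell.AlgLog L x := by
    intro x hx
    refine Submodule.span_induction (p := fun x _ => Ell.AlgLog L x) ?_ ?_ ?_ ?_ hx
    · intro x hx
      obtain ⟨s, _, rfl⟩ := Finset.mem_image.1 (Finset.mem_coe.1 hx)
      exact hwA s
    · exact Ell.algLog_zero
    · intro x y _ _ hx hy
      exact hx.add L h₂ hy
    · intro z x _ hx
      rw [zsmul_eq_mul]
      exact hx.zsmul L h₂ z
  have hmA : ∀ l, Ell.AlgLog L (m l) := fun l => hMalg _ (bM l).2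
  have hli : LinearIndependent ℤ m := by
    have h := bM.linearIndependent.map' Msp.subtype (Submodule.ker_subtype Msp)
    exact h
  -- integer coordinates of each `w s`
  have keyn : ∀ s : PeriodSymbol, ∃ n : Fin r → ℤ, s ∈ c.support →
      ∑ l, (n l : ℂ) * m l = w s := by
    intro s
    by_cases hs : s ∈ c.support
    · have hmem : w s ∈ Msp := Submodule.subset_span (Finset.mem_coe.2 (Finset.mem_image_of_mem w hs))
      refine ⟨fun l => bM.repr ⟨w s, hmem⟩ l, fun _ => ?_⟩
      have h := congrArg (fun y : Msp => (y : ℂ)) (bM.sum_repr ⟨w s, hmem⟩)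
      simp only [Submodule.coe_sum, Submodule.coe_smul_of_tower, zsmul_eq_mul] at h
      exact h
    · exact ⟨0, fun h => (hs h).elim⟩
  choose n hn using keyn
  -- Phase C: the generic base point and the basis lifts
  choose Bexp hBexp using fun s : PeriodSymbol => Ell.zexpand (L := L) h₂ h₃ r m hmA (n s)
  set BD : PeriodSymbol → Finset ℂ := fun s => {z₀ s, 2 * z₀ s, z₀ s - z₁ s, z₀ s + z₁ s} with hBD
  set Bast : Finset ℂ := Finset.univ.biUnion fun l : Fin r => ({m l, -m l} : Finset ℂ) with hBast
  set Bset : Finset ℂ := (c.support.biUnion fun s => Bexp s ∪ BD s) ∪ Bast with hBset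
  obtain ⟨t₀, ht₀, hgen⟩ := Ell.exists_generic_algPt L h₂ h₃ Bset
  have hgen_exp : ∀ s ∈ c.support, ∀ b' ∈ Bexp s, t₀ - b' ∉ L.lattice := fun s hs b' hb' =>
    hgen b' (Finset.mem_union_left _ (Finset.mem_biUnion.2 ⟨s, hs, Finset.mem_union_left _ hb'⟩))
  have hgen_D : ∀ s ∈ c.support, ∀ b' ∈ BD s, t₀ - b' ∉ L.lattice := fun s hs b' hb' =>
    hgen b' (Finset.mem_union_left _ (Finset.mem_biUnion.2 ⟨s, hs, Finset.mem_union_right _ hb'⟩))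
  have hgen_ast : ∀ l, t₀ - m l ∉ L.lattice ∧ t₀ + m l ∉ L.lattice := fun l => by
    have h1 := hgen (m l) (Finset.mem_union_right _ (Finset.mem_biUnion.2 ⟨l, Finset.mem_univ _, by simp⟩))
    have h2 := hgen (-m l) (Finset.mem_union_right _ (Finset.mem_biUnion.2 ⟨l, Finset.mem_univ _, by simp⟩))
    exact ⟨h1, by simpa using h2⟩
  have hDUalg : ∀ l, Ell.IsAlgPt L (t₀ + m l) := fun l =>
    (ht₀.algLog.add L h₂ (hmA l)).isAlgPt (hgen_ast l).2
  set DU : ∀ l : Fin r, Ell.LiftData L t₀ (t₀ + m l) := fun l =>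
    (Ell.LiftData.nonempty (L := L) ht₀ (hDUalg l)).some with hDU
  -- Phase D: per symbol, `s ∼ liftPart (a n) (b n) + d ℓ + E 𝟙`
  have hper : ∀ s ∈ c.support, ∃ e' : ℂ, IsAlgebraic ℚ e' ∧
      InSpan (Finsupp.single s (1 : ℂ) -
        Ell.liftPart h₂ h₃ DU (fun l => a s * (n s l : ℂ)) (fun l => b s * (n s l : ℂ)) -
        d s • Finsupp.single (logSym (E s)) (1 : ℂ) -
        e' • Finsupp.single PeriodSymbol.unit (1 : ℂ)) := by
    intro s hs
    obtain ⟨ha, hb, -, -, -, he, hrel⟩ := hkey s hs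
    -- genericity at `s`
    have hz0 : t₀ - z₀ s ∉ L.lattice := hgen_D s hs _ (by simp [hBD])
    have h2z0 : t₀ - 2 * z₀ s ∉ L.lattice := hgen_D s hs _ (by simp [hBD])
    have hdiff : t₀ - (z₀ s - z₁ s) ∉ L.lattice := hgen_D s hs _ (by simp [hBD])
    have hsum01 : t₀ - (z₀ s + z₁ s) ∉ L.lattice := hgen_D s hs _ (by simp [hBD])
    set v : ℂ := t₀ - z₀ s with hv
    have hvA : Ell.AlgLog L v := ht₀.algLog.sub L h₂ (Dl s).alg_start.algLog
    have hvalg : Ell.IsAlgPt L v := hvA.isAlgPt hz0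
    have hne0 : ℘[L] (z₀ s) ≠ ℘[L] v := by
      refine (Ell.weierstrassP_ne_iff L (Dl s).alg_start.1 hvalg.1).2 ⟨?_, ?_⟩
      · have e : z₀ s + v = t₀ := by rw [hv]; ring
        rw [e]; exact ht₀.1
      · intro h
        apply h2z0
        have e : t₀ - 2 * z₀ s = -(z₀ s - v) := by rw [hv]; ring
        rw [e]; exact neg_mem h
    have hne1 : ℘[L] (z₁ s) ≠ ℘[L] v := by
      refine (Ell.weierstrassP_ne_iff L (Dl s).alg_stop.1 hvalg.1).2 ⟨?_, ?_⟩
      · have e : z₁ s + v = t₀ - (z₀ s - z₁ s) := by rw [hv]; ring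
        rw [e]; exact hdiff
      · intro h
        apply hsum01
        have e : t₀ - (z₀ s + z₁ s) = -(z₁ s - v) := by rw [hv]; ring
        rw [e]; exact neg_mem h
    have hws : Ell.IsAlgPt L (t₀ + w s) := by
      refine (ht₀.algLog.add L h₂ (hwA s)).isAlgPt ?_
      have e : t₀ + w s = t₀ - (z₀ s - z₁ s) := by rw [hw]; ring
      rw [e]; exact hdiff
    obtain ⟨Dtr⟩ := Ell.LiftData.nonempty (L := L) (a := t₀) (b := t₀ + w s) ht₀ hws
    have ea : t₀ = z₀ s + v := by rw [hv]; ring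
    have eb : t₀ + w s = z₁ s + v := by rw [hv, hw]; ring
    -- translation
    have rt0 := Ell.LiftData.span_translate_theta0 h₂ h₃ hvalg (Dl s) (Dtr.cast ea eb) hne0 hne1
    have rt1 := Ell.LiftData.span_translate_theta1 h₂ h₃ hvalg (Dl s) (Dtr.cast ea eb) hne0 hne1
    rw [Ell.LiftData.sym_cast] at rt0 rt1
    have hκ := Ell.isAlgebraic_translate_const L hvalg (Dl s).alg_start (Dl s).alg_stop
    -- expansion
    obtain ⟨-, -, hall⟩ := hBexp s t₀ ht₀ (hgen_exp s hs)
    have esum : t₀ + w s = t₀ + ∑ l, (n s l : ℂ) * m l := by rw [hn s hs]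
    obtain ⟨rx0, cx, hcx, rx1⟩ := hall (Dtr.cast rfl esum) DU
    rw [Ell.LiftData.sym_cast] at rx0 rx1
    refine ⟨e s + b s * (cx - (eval (Ell.psiT L v (z₁ s)) (Ell.rPolyT L v) -
        eval (Ell.psiT L v (z₀ s)) (Ell.rPolyT L v))), he.add (hb.mul (hcx.sub hκ)), ?_⟩
    obtain ⟨K, ρ, cf, hρ, hcf, hsum⟩ :=
      span_add (span_add hrel (span_smul ha (span_sub rx0 rt0))) (span_smul hb (span_sub rx1 rt1))
    refine ⟨K, ρ, cf, hρ, hcf, ?_⟩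
    rw [← hsum]
    simp only [Ell.liftPart, smul_sub, Finset.smul_sum, smul_smul, add_smul, sub_smul, mul_sub]
    abel
  have hper' : ∀ s : PeriodSymbol, ∃ e' : ℂ, s ∈ c.support → (IsAlgebraic ℚ e' ∧
      InSpan (Finsupp.single s (1 : ℂ) -
        Ell.liftPart h₂ h₃ DU (fun l => a s * (n s l : ℂ)) (fun l => b s * (n s l : ℂ)) -
        d s • Finsupp.single (logSym (E s)) (1 : ℂ) -
        e' • Finsupp.single PeriodSymbol.unit (1 : ℂ))) := by
    intro s
    by_cases hs : s ∈ c.support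
    · obtain ⟨e', he', h⟩ := hper s hs
      exact ⟨e', fun _ => ⟨he', h⟩⟩
    · exact ⟨0, fun h => (hs h).elim⟩
  choose e' he' using hper'
  -- Phase E: the logarithms (a `ℚ`-basis), as in the genus-0 case
  set S : Finset ℂ := c.support.image M with hS
  obtain ⟨bq, hbS, hspan, hliq⟩ := exists_linearIndependent ℚ (↑S : Set ℂ)
  have hbfin : bq.Finite := S.finite_toSet.subset hbS
  set Bs : Finset ℂ := hbfin.toFinset with hBs
  have hBb : (↑Bs : Set ℂ) = bq := hbfin.coe_toFinset
  have halgB : ∀ x : Bs, IsAlgebraic ℚ (exp (x : ℂ)) := by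
    rintro ⟨x, hx⟩
    have hx' : x ∈ S := by
      have : x ∈ bq := by rw [← hBb]; exact hx
      exact hbS this
    obtain ⟨s, hs, rfl⟩ := Finset.mem_image.1 hx'
    exact (hkey s hs).2.2.1
  have hliB : LinearIndependent ℚ (fun x : Bs => (x : ℂ)) := by
    rw [← hBb] at hliq
    exact hliq
  have keyB : ∀ x : Bs, ∃ Em : CurvePath (⟨2, 1, ![X 0 * X 1 - 1]⟩ : CurveData),
      ∀ t, Em.toFun t = ![exp ((1 - t) * 0 + t * (x : ℂ)), exp (-((1 - t) * 0 + t * (x : ℂ)))] :=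
    fun x => exists_expPath (L₀ := 0) (L₁ := (x : ℂ)) isAlgebraic_exp_zero (halgB x)
  choose Em hEm using keyB
  have keyq : ∀ s : PeriodSymbol, ∃ q : Bs → ℚ, s ∈ c.support →
      ∑ i, (q i : ℂ) * (i : ℂ) = M s := by
    intro s
    by_cases hs : s ∈ c.support
    · have hmem : M s ∈ Submodule.span ℚ (Set.range fun x : Bs => (x : ℂ)) := by
        have hrange : Set.range (fun x : Bs => (x : ℂ)) = (↑Bs : Set ℂ) := Subtype.range_coe
        rw [hrange, hBb, hspan]
        exact Submodule.subset_span (Finset.mem_coe.2 (Finset.mem_image_of_mem M hs))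
      obtain ⟨q, hq⟩ := (Submodule.mem_span_range_iff_exists_fun ℚ).1 hmem
      refine ⟨q, fun _ => ?_⟩
      rw [← hq]
      exact Finset.sum_congr rfl fun i _ => by rw [Rat.smul_def]
    · exact ⟨0, fun h => (hs h).elim⟩
  choose q hq using keyq
  -- per symbol, with the logarithm expanded
  have hper_s : ∀ s ∈ c.support, InSpan (Finsupp.single s (1 : ℂ) -
      Ell.liftPart h₂ h₃ DU (fun l => a s * (n s l : ℂ)) (fun l => b s * (n s l : ℂ)) -
      d s • ∑ i : Bs, (q s i : ℂ) • Finsupp.single (logSym (Em i)) (1 : ℂ) -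
      e' s • Finsupp.single PeriodSymbol.unit (1 : ℂ)) := by
    intro s hs
    obtain ⟨_, _, _, hEs, hds, _, _⟩ := hkey s hs
    obtain ⟨_, hrel⟩ := he' s hs
    have hsum := span_logSym_sum (Finset.univ : Finset Bs) (fun x : Bs => (x : ℂ)) halgB (q s) Em
      (fun i t => hEm i t) (E s) (fun t => by rw [hEs, hq s hs])
    obtain ⟨k, ρ, cf, hρ, hcf, he⟩ := span_add hrel (span_smul hds hsum)
    exact ⟨k, ρ, cf, hρ, hcf, by rw [← he, smul_sub]; abel⟩
  -- sum over the support
  have hspan' : ∀ T : Finset PeriodSymbol, T ⊆ c.support →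
      InSpan (∑ s ∈ T, c s • (Finsupp.single s (1 : ℂ) -
        Ell.liftPart h₂ h₃ DU (fun l => a s * (n s l : ℂ)) (fun l => b s * (n s l : ℂ)) -
        d s • ∑ i : Bs, (q s i : ℂ) • Finsupp.single (logSym (Em i)) (1 : ℂ) -
        e' s • Finsupp.single PeriodSymbol.unit (1 : ℂ))) := by
    intro T hT
    induction T using Finset.induction_on with
    | empty => simpa using span_zero
    | insert s T hs ih =>
      rw [Finset.sum_insert hs]
      exact span_add (span_smul (hc s) (hper_s s (hT (Finset.mem_insert_self s T))))
        (ih (subset_trans (Finset.subset_insert s T) hT))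
  obtain ⟨k, ρ, cf, hρ, hcf, hmain⟩ := hspan' c.support subset_rfl
  -- the subtracted element `W = liftPart Atot Btot + Σ_i D_i ℓ(i) + e_tot 𝟙`
  set Atot : Fin r → ℂ := ∑ s ∈ c.support, c s • fun l => a s * (n s l : ℂ) with hAtot
  set Btot : Fin r → ℂ := ∑ s ∈ c.support, c s • fun l => b s * (n s l : ℂ) with hBtot
  set Dg : Bs → ℂ := fun i => ∑ s ∈ c.support, c s * d s * (q s i : ℂ) with hDg
  set etot : ℂ := ∑ s ∈ c.support, c s * e' s with hetot
  have hc_eq : c = ∑ s ∈ c.support, c s • Finsupp.single s (1 : ℂ) := by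
    conv_lhs => rw [← Finsupp.sum_single c]
    simp only [Finsupp.sum, Finsupp.smul_single_one]
  have hident : ∑ s ∈ c.support, c s • (Finsupp.single s (1 : ℂ) -
        Ell.liftPart h₂ h₃ DU (fun l => a s * (n s l : ℂ)) (fun l => b s * (n s l : ℂ)) -
        d s • ∑ i : Bs, (q s i : ℂ) • Finsupp.single (logSym (Em i)) (1 : ℂ) -
        e' s • Finsupp.single PeriodSymbol.unit (1 : ℂ)) =
      c - (Ell.liftPart h₂ h₃ DU Atot Btot + ∑ i : Bs, Dg i • Finsupp.single (logSym (Em i)) (1 : ℂ) +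
        etot • Finsupp.single PeriodSymbol.unit (1 : ℂ)) := by
    have e1 : ∀ s, c s • (Finsupp.single s (1 : ℂ) -
        Ell.liftPart h₂ h₃ DU (fun l => a s * (n s l : ℂ)) (fun l => b s * (n s l : ℂ)) -
        d s • ∑ i : Bs, (q s i : ℂ) • Finsupp.single (logSym (Em i)) (1 : ℂ) -
        e' s • Finsupp.single PeriodSymbol.unit (1 : ℂ)) =
        c s • Finsupp.single s (1 : ℂ) -
          Ell.liftPart h₂ h₃ DU (c s • fun l => a s * (n s l : ℂ)) (c s • fun l => b s * (n s l : ℂ)) -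
          ∑ i : Bs, (c s * d s * (q s i : ℂ)) • Finsupp.single (logSym (Em i)) (1 : ℂ) -
          (c s * e' s) • Finsupp.single PeriodSymbol.unit (1 : ℂ) := by
      intro s
      rw [smul_sub, smul_sub, smul_sub, Ell.smul_liftPart, smul_smul, Finset.smul_sum, smul_smul]
      congr 2
      exact Finset.sum_congr rfl fun i _ => by rw [smul_smul]
    simp_rw [e1]
    rw [Finset.sum_sub_distrib, Finset.sum_sub_distrib, Finset.sum_sub_distrib, ← hc_eq,
      Ell.liftPart_finset_sum, Finset.sum_comm, hDg, hetot, Finset.sum_smul]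
    simp_rw [Finset.sum_smul]
    abel
  rw [hident] at hmain
  -- the period of `W` vanishes
  set tζ : Fin r → ℂ := fun l => L.weierstrassZeta (t₀ + m l) - L.weierstrassZeta t₀ with htζ
  have hevW : (∑ l, Atot l * (2 * m l)) + (∑ l, Btot l * (-2 * tζ l)) +
      (∑ i : Bs, Dg i * (i : ℂ)) + etot = 0 := by
    have h1 := evalCombination_eq_zero_of_isElementaryRelation ρ cf hρ
    rw [← hmain, sub_eq_add_neg, evalCombination_add, h0, zero_add, ← neg_one_smul ℂ,
      evalCombination_smul, evalCombination_add, evalCombination_add, evalCombination_finsetSum,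
      evalCombination_smul, evalCombination_single, period_unit,
      Ell.evalCombination_liftPart] at h1
    have h2 : ∀ i : Bs, evalCombination (Dg i • Finsupp.single (logSym (Em i)) (1 : ℂ)) =
        Dg i * (i : ℂ) := fun i => by
      rw [evalCombination_smul, evalCombination_single, period_ydx_expPath 0 (i : ℂ) (Em i)
        (hEm i), sub_zero, one_mul]
    simp_rw [h2] at h1
    rw [neg_one_mul, neg_eq_zero] at h1
    simpa [htζ] using h1
  -- algebraicity of the coefficients
  have hqalg : ∀ s (i : Bs), IsAlgebraic ℚ ((q s i : ℚ) : ℂ) := fun s i => by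
    simpa using isAlgebraic_algebraMap (R := ℚ) (A := ℂ) (q s i)
  have hnalg : ∀ s (l : Fin r), IsAlgebraic ℚ ((n s l : ℤ) : ℂ) := fun s l => isAlgebraic_int _
  have hDalg : ∀ i, IsAlgebraic ℚ (Dg i) := fun i =>
    isAlgebraic_finsetSum _ _ fun s hs => ((hc s).mul (hkey s hs).2.2.2.2.1).mul (hqalg s i)
  have hetalg : IsAlgebraic ℚ etot :=
    isAlgebraic_finsetSum _ _ fun s hs => (hc s).mul (he' s hs).1
  have hAalg : ∀ l, IsAlgebraic ℚ (Atot l) := fun l => by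
    rw [hAtot, Finset.sum_apply]
    exact isAlgebraic_finsetSum _ _ fun s hs => (hc s).mul (((hkey s hs).1).mul (hnalg s l))
  have hBalg : ∀ l, IsAlgebraic ℚ (Btot l) := fun l => by
    rw [hBtot, Finset.sum_apply]
    exact isAlgebraic_finsetSum _ _ fun s hs => (hc s).mul (((hkey s hs).2.1).mul (hnalg s l))
  -- the analytic subgroup theorem at `u = (1; (log m_i); (m_l, ζ(t₀ + m_l) − ζ t₀))`
  set γc : Unit ⊕ (Bs ⊕ (Fin r ⊕ Fin r)) → ℂ :=
    lieCoords etot Dg (fun l => 2 * Atot l) (fun l => -2 * Btot l) with hγc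
  have hγalg : ∀ x, IsAlgebraic ℚ (γc x) := by
    rintro (_ | i | l | l)
    · exact hetalg
    · exact hDalg i
    · simpa [hγc] using Ell.isAlgebraic_two.mul (hAalg l)
    · simpa [hγc] using Ell.isAlgebraic_two.neg.mul (hBalg l)
  have hγsum : ∑ x, γc x * lieCoords 1 (fun i : Bs => (i : ℂ)) m tζ x = 0 := by
    simp only [Fintype.sum_sum_type, Finset.univ_unique, Finset.sum_singleton, hγc, lieCoords_inl,
      lieCoords_inr_inl, lieCoords_inr_inr_inl, lieCoords_inr_inr_inr]
    have e1 : ∑ l, 2 * Atot l * m l = ∑ l, Atot l * (2 * m l) :=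
      Finset.sum_congr rfl fun l _ => by ring
    have e2 : ∑ l, -2 * Btot l * tζ l = ∑ l, Btot l * (-2 * tζ l) :=
      Finset.sum_congr rfl fun l _ => by ring
    rw [e1, e2]
    linear_combination hevW
  have hpts : ∀ l, L.IsUnivExtAlgPoint (m l) (tζ l) := fun l =>
    Ell.isUnivExtAlgPoint_shift ht₀ (hmA l) (hgen_ast l).2 (hgen_ast l).1
  have hzero : ∀ x, γc x = 0 := by
    by_contra hne
    push Not at hne
    obtain ⟨x₀, hx₀⟩ := hne
    have hdep : ¬ QbarLinearIndependent (lieCoords 1 (fun i : Bs => (i : ℂ)) m tζ) :=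
      fun hQ => hx₀ (hQ γc hγalg hγsum x₀)
    have hAST' := hAST L h₂ h₃ hCM Bs (Fin r) 1 (fun i : Bs => (i : ℂ)) m tζ
      isAlgebraic_one halgB hpts hdep
    rcases hAST' with h0' | ⟨p, hp, hpy⟩ | ⟨a', ha', haz⟩
    · exact one_ne_zero h0'
    · exact not_int_rel_of_linearIndependent hliB p hp hpy
    · exact not_int_rel_of_linearIndependent_int hli a' ha' haz
  have het0 : etot = 0 := by simpa [hγc] using hzero (Sum.inl ())
  have hD0 : ∀ i, Dg i = 0 := fun i => by simpa [hγc] using hzero (Sum.inr (Sum.inl i))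
  have hA0 : ∀ l, Atot l = 0 := fun l => by
    have h := hzero (Sum.inr (Sum.inr (Sum.inl l)))
    simpa [hγc] using h
  have hB0 : ∀ l, Btot l = 0 := fun l => by
    have h := hzero (Sum.inr (Sum.inr (Sum.inr l)))
    simpa [hγc] using h
  have hAtot0 : Atot = 0 := funext hA0
  have hBtot0 : Btot = 0 := funext hB0
  refine ⟨k, ρ, cf, hρ, hcf, ?_⟩
  rw [← hmain, hAtot0, hBtot0, Ell.liftPart_zero]
  simp [hD0, het0]

-- The punctured line `Z_a = {(x, y) | y · ∏ᵢ (x − aᵢ) = 1} ⊂ 𝔸²` (`≅ 𝔸¹ ∖ {a₁, …, a_r}`), as in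
-- `CurvePeriodsPuncturedLineProofs.lean`.
local notation3 (prettyPrint := false) "ZP " a:arg =>
  (⟨2, 1, ![X 1 * ∏ i, (X 0 - C (a i)) - 1]⟩ : CurveData)

/-- **Huber–Wüstholz, Theorem 13.3 (2), for the sub-diagram "genus `0` + one non-CM elliptic
curve" — all paths — from the analytic subgroup theorem.** A vanishing `ℚ̄`-linear combination of
period symbols on the punctured lines `Z_a` (`a : Fin r → ℚ̄` injective), on `𝔾ₘ`, on `𝔸¹` and on
`E_L` (`g₂, g₃ ∈ ℚ̄`, no CM), all with arbitrary `C¹` paths with algebraic end points, is a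
`ℚ̄`-linear combination of the elementary relations (R1)–(R5) (`exists_transfer_puncturedLine`,
`span_of_transfer_finsupp`, then `huberWustholzCurvePeriods_of_ellipticPaths`).
[cite: HuberWustholz2022, Thm. 13.3 (2) (p. 121), §13.2 (pp. 122–125), Ch. 15] -/
theorem huberWustholzCurvePeriods_of_puncturedLine_or_ellipticPaths
    (hAST : analyticSubgroupTheorem_GaGmE)
    (L : PeriodPair) (h₂ : IsAlgebraic ℚ L.g₂) (h₃ : IsAlgebraic ℚ L.g₃) (hCM : ¬ L.HasCM)
    (c : PeriodSymbol →₀ ℂ) (hc : ∀ s, IsAlgebraic ℚ (c s))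
    (hsupp : ∀ s ∈ c.support,
      (∃ (r : ℕ) (a : Fin r → ℂ), Function.Injective a ∧ (∀ i, IsAlgebraic ℚ (a i)) ∧
        s.Z = ZP a) ∨
      s.Z = Ell.curve L ∨ s.Z = (⟨2, 1, ![X 0 * X 1 - 1]⟩ : CurveData) ∨ s.Z = CurveData.affineLine)
    (h0 : evalCombination c = 0) :
    ∃ (k : ℕ) (ρ : Fin k → (PeriodSymbol →₀ ℂ)) (a : Fin k → ℂ),
      (∀ l, IsElementaryRelation (ρ l)) ∧ (∀ l, IsAlgebraic ℚ (a l)) ∧ c = ∑ l, a l • ρ l := by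
  classical
  have key : ∀ s : PeriodSymbol, ∃ V : PeriodSymbol →₀ ℂ, s ∈ c.support →
      ((∀ t, IsAlgebraic ℚ (V t)) ∧ InSpan (Finsupp.single s 1 - V) ∧
        (∀ t ∈ V.support,
          t.Z = Ell.curve L ∨ t.Z = (⟨2, 1, ![X 0 * X 1 - 1]⟩ : CurveData) ∨
            t.Z = CurveData.affineLine)) := by
    intro s
    by_cases hs : s ∈ c.support
    · rcases hsupp s hs with ⟨r, a, hinj, ha, hsZ⟩ | hrest
      · obtain ⟨Z, hZ, ω, hω, γ⟩ := s
        dsimp only at hsZ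
        subst hsZ
        obtain rfl : hZ = isSmoothAffineCurve_puncturedLine ha := rfl
        obtain ⟨cf, γ', e, hcf, he, hrel⟩ := exists_transfer_puncturedLine ha hinj ω hω γ
        refine ⟨∑ i, cf i • Finsupp.single (⟨⟨2, 1, ![X 0 * X 1 - 1]⟩,
            isSmoothAffineCurve_mulGroup, ![X 1, 0], hasAlgCoeffs_ydx, γ' i⟩ : PeriodSymbol)
            (1 : ℂ) + e • Finsupp.single PeriodSymbol.unit (1 : ℂ), fun _ => ⟨?_, ?_, ?_⟩⟩
        · intro t
          rw [Finsupp.add_apply, Finsupp.finsetSum_apply, Finsupp.smul_apply, smul_eq_mul]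
          refine (isAlgebraic_finsetSum _ _ fun i _ => ?_).add
            (he.mul (isAlgebraic_single_one_apply _ _))
          rw [Finsupp.smul_apply, smul_eq_mul]
          exact (hcf i).mul (isAlgebraic_single_one_apply _ _)
        · obtain ⟨k, ρ, b, hρ, hb, hsum⟩ := hrel
          exact ⟨k, ρ, b, hρ, hb, by rw [← hsum]; abel⟩
        · intro t ht
          rcases Finset.mem_union.1 (Finsupp.support_add ht) with h1 | h2
          · obtain ⟨i, _, hi⟩ := Finset.mem_biUnion.1 (Finsupp.support_finsetSum h1)
            have h3 := (Finsupp.mem_support_single _ _ _).1 (Finsupp.support_smul hi)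
            exact Or.inr (Or.inl (by rw [h3.1]))
          · have h3 := (Finsupp.mem_support_single _ _ _).1 (Finsupp.support_smul h2)
            exact Or.inr (Or.inr (by rw [h3.1]; rfl))
      · exact ⟨Finsupp.single s 1, fun _ => ⟨fun t => isAlgebraic_single_one_apply _ _,
          by rw [sub_self]; exact span_zero, fun t ht => by
            have h3 := (Finsupp.mem_support_single _ _ _).1 ht
            rw [h3.1]
            exact hrest⟩⟩
    · exact ⟨0, fun h => (hs h).elim⟩
  choose V hV using key
  exact span_of_transfer_finsupp c hc V (fun s hs => (hV s hs).1) (fun s hs => (hV s hs).2.1)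
    (fun t => t.Z = Ell.curve L ∨ t.Z = (⟨2, 1, ![X 0 * X 1 - 1]⟩ : CurveData) ∨
      t.Z = CurveData.affineLine)
    (fun s hs => (hV s hs).2.2)
    (fun c' hc' hsupp' h0' =>
      huberWustholzCurvePeriods_of_ellipticPaths hAST L h₂ h₃ hCM c' hc' hsupp' h0')
    h0

end Main

end CurvePeriods

end Literature.NumberTheory.Transcendental

end
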